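import Literature.Topology.FourManifolds.KnotFamilyAmbientIsotopy
import Literature.Topology.FourManifolds.BandRebuildCurve
import HarnessLib

/-!
# Planar families on an embedded sheet: isotoping a knot by moving a planar track

Topic `Literature/Topology/FourManifolds`; fact seat `provefact-IsStrictHandleSlide.isSurgery`
(R. C. Kirby, *The Topology of 4-Manifolds*, LNM 1374 (1989), Ch. I §4; remaining content: the
named fact (S) `Literature.Topology.FourManifolds.FramedLink.IsStrictHandleSlide.slideModel`).
Generalisation of `PlanarBandFamily.lean` from the band of band-sum data to an **arbitrary sheet**:
a map `E : ℝ² → S³` which is `C^∞`, injective and immersive on an open set `U ⊆ ℝ²` (the finger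
move of the handle slide pushes the attaching circle along the extended flat sheet through the
push-off into the collar, which is not a band). A smooth family of planar tracks `P u` in `U`,
agreeing with `P 0` off an inner interval, regular and injective, with `k = E ∘ P 0` on the
parameter interval `S` and `E ∘ P u` avoiding the rest of `k`, is a family of modifications of `k`
(`Knot.IsModification`), hence `k` is ambient isotopic (with support) to the knot with track `P 1`.
Everything proved; no definitions of mathematical content beyond the structure and the end knot;
no named facts.

* `Literature.Topology.FourManifolds.SheetFamily` and its API (`fam`, `isModification`, `outKnot`,
  `outKnot_circlePt_of_mem`, `outKnot_circlePt_of_not_mem`, `exists_ambientIsotopy`).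

## References

* M. W. Hirsch, *Differential Topology*, GTM 33, Springer (1976), Ch. 8 §1, Thm. 1.3. [HirschDT1976]
* R. C. Kirby, *The Topology of 4-Manifolds*, LNM 1374, Springer (1989), Ch. I §4. [Kirby1989]
-/

open scoped Manifold ContDiff Topology Real
open Function Set Metric Filter

noncomputable section

namespace Literature.Topology.FourManifolds

/-- **A planar family on a sheet.** `E : ℝ² → S³` is `C^∞` (read in `ℝ⁴`), injective and
immersive on the open set `U`; `P : ℝ → ℝ → ℝ²` is a smooth family of tracks in `U` over the
parameter interval `S = [s₁, s₂]` of the knot `k` (inside the fundamental domain `[a, a + 1)`),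
agreeing with `P 0` off the inner interval `(s₁', s₂')`, regular and injective, with
`k = E ∘ P 0` on `S` and `E ∘ P u` off the rest of `k`; the composite `E ∘ P` is globally smooth.
[cite: HirschDT1976, Ch. 8 §1, Thm. 1.3] -/
structure SheetFamily (E : EuclideanSpace ℝ (Fin 2) → Metric.sphere (0 : EuclideanSpace ℝ (Fin 4)) 1)
    (U : Set (EuclideanSpace ℝ (Fin 2))) (k : Knot) (a ε s₁ s₁' s₂' s₂ : ℝ)
    (P : ℝ → ℝ → EuclideanSpace ℝ (Fin 2)) : Prop where
  isOpen : IsOpen U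
  smooth : ContDiffOn ℝ ∞ (fun x ↦ ((E x : Metric.sphere (0 : EuclideanSpace ℝ (Fin 4)) 1) : EuclideanSpace ℝ (Fin 4))) U
  inj : InjOn E U
  immersion : ∀ x ∈ U, Injective (fderiv ℝ (fun x ↦ ((E x : Metric.sphere (0 : EuclideanSpace ℝ (Fin 4)) 1) :
    EuclideanSpace ℝ (Fin 4))) x)
  ε_pos : 0 < ε
  hs : a + ε ≤ s₁ ∧ s₁ < s₁' ∧ s₁' < s₂' ∧ s₂' < s₂ ∧ s₂ ≤ a + 1 - ε
  contDiff : ContDiff ℝ ∞ (uncurry P)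
  /-- The sheet composed with the family is jointly `C^∞` on all of `ℝ × ℝ` (the sheet itself need
  only be smooth on `U`; off the parameter interval the tracks may leave `U` as long as the
  composite stays smooth). -/
  smooth_comp : ContDiff ℝ ∞ (fun p : ℝ × ℝ ↦ ((E (P p.1 p.2) : Metric.sphere (0 : EuclideanSpace ℝ (Fin 4)) 1) :
    EuclideanSpace ℝ (Fin 4)))
  /-- On the parameter interval the tracks lie in `U`. -/
  memU : ∀ u ∈ Icc (0 : ℝ) 1, ∀ s ∈ Icc s₁ s₂, P u s ∈ U
  eq_zero : ∀ u t, t ∉ Ioo s₁' s₂' → P u t = P 0 t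
  curve_eq : ∀ s ∈ Icc s₁ s₂, Knot.curve k s = ((E (P 0 s) : Metric.sphere (0 : EuclideanSpace ℝ (Fin 4)) 1) :
    EuclideanSpace ℝ (Fin 4))
  deriv_ne : ∀ u ∈ Icc (0 : ℝ) 1, ∀ s ∈ Icc s₁ s₂, deriv (P u) s ≠ 0
  injOn : ∀ u ∈ Icc (0 : ℝ) 1, InjOn (P u) (Icc s₁ s₂)
  disjoint : ∀ u ∈ Icc (0 : ℝ) 1, ∀ s ∈ Icc s₁ s₂, ∀ t ∈ Ico a (a + 1), t ∉ Icc s₁ s₂ →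
    ((E (P u s) : Metric.sphere (0 : EuclideanSpace ℝ (Fin 4)) 1) : EuclideanSpace ℝ (Fin 4)) ≠ Knot.curve k t

namespace SheetFamily

variable {E : EuclideanSpace ℝ (Fin 2) → Metric.sphere (0 : EuclideanSpace ℝ (Fin 4)) 1}
  {U : Set (EuclideanSpace ℝ (Fin 2))} {k : Knot} {a ε s₁ s₁' s₂' s₂ : ℝ} {P : ℝ → ℝ → EuclideanSpace ℝ (Fin 2)}
  (h : SheetFamily E U k a ε s₁ s₁' s₂' s₂ P)
include h

/-- **The family of piece functions**: the curve of `k` plus the sheet displacement. [folklore] -/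
def fam (_ : SheetFamily E U k a ε s₁ s₁' s₂' s₂ P) (u t : ℝ) : EuclideanSpace ℝ (Fin 4) :=
  Knot.curve k t + ((((E (P u t)) : Metric.sphere (0 : EuclideanSpace ℝ (Fin 4)) 1) : EuclideanSpace ℝ (Fin 4)) -
    (((E (P 0 t)) : Metric.sphere (0 : EuclideanSpace ℝ (Fin 4)) 1) : EuclideanSpace ℝ (Fin 4)))

/-- Off the inner interval the family is the curve of `k`. [folklore] -/
theorem fam_of_not_mem (u : ℝ) {t : ℝ} (ht : t ∉ Ioo s₁' s₂') : h.fam u t = Knot.curve k t := by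
  rw [fam, h.eq_zero u t ht, sub_self, add_zero]

/-- On `S` the family is the sheet image of the track. [folklore] -/
theorem fam_of_mem (u : ℝ) {s : ℝ} (hs : s ∈ Icc s₁ s₂) :
    h.fam u s = ((E (P u s) : Metric.sphere (0 : EuclideanSpace ℝ (Fin 4)) 1) : EuclideanSpace ℝ (Fin 4)) := by
  rw [fam, h.curve_eq s hs]; abel

/-- At `u = 0` the family is the curve of `k`. [folklore] -/
theorem fam_zero (t : ℝ) : h.fam 0 t = Knot.curve k t := by
  rw [fam, sub_self, add_zero]

/-- The sheet composed with the family is jointly `C^∞`. [folklore] -/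
theorem contDiff_coe_comp : ContDiff ℝ ∞ fun p : ℝ × ℝ ↦
    ((E (P p.1 p.2) : Metric.sphere (0 : EuclideanSpace ℝ (Fin 4)) 1) : EuclideanSpace ℝ (Fin 4)) := h.smooth_comp

/-- The family is jointly `C^∞`. [folklore] -/
theorem contDiff_fam : ContDiff ℝ ∞ (uncurry h.fam) := by
  have h1 : ContDiff ℝ ∞ fun p : ℝ × ℝ ↦ Knot.curve k p.2 := k.contDiff_curve.comp contDiff_snd
  have h2 := h.contDiff_coe_comp
  have h3 : ContDiff ℝ ∞ fun p : ℝ × ℝ ↦ ((E (P 0 p.2) : Metric.sphere (0 : EuclideanSpace ℝ (Fin 4)) 1) :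
      EuclideanSpace ℝ (Fin 4)) := h2.comp (contDiff_const.prodMk contDiff_snd)
  exact h1.add (h2.sub h3)

/-- Each track is `C^∞`. [folklore] -/
theorem contDiff_track (u : ℝ) : ContDiff ℝ ∞ (P u) := h.contDiff.comp (contDiff_const.prodMk contDiff_id)

/-- The sheet image of a track has nonzero derivative on `S`. [folklore] -/
theorem deriv_coe_track_ne_zero {u : ℝ} (hu : u ∈ Icc (0 : ℝ) 1) {s : ℝ} (hs : s ∈ Icc s₁ s₂) :
    deriv (fun t ↦ ((E (P u t) : Metric.sphere (0 : EuclideanSpace ℝ (Fin 4)) 1) : EuclideanSpace ℝ (Fin 4))) s ≠ 0 := by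
  have hx := h.memU u hu s hs
  have hEd : HasFDerivAt (fun x ↦ ((E x : Metric.sphere (0 : EuclideanSpace ℝ (Fin 4)) 1) : EuclideanSpace ℝ (Fin 4)))
      (fderiv ℝ (fun x ↦ ((E x : Metric.sphere (0 : EuclideanSpace ℝ (Fin 4)) 1) : EuclideanSpace ℝ (Fin 4))) (P u s)) (P u s) :=
    ((h.smooth.contDiffAt (h.isOpen.mem_nhds hx)).differentiableAt (by simp)).hasFDerivAt
  have hPd : HasDerivAt (P u) (deriv (P u) s) s := (((h.contDiff_track u).differentiable (by simp)) s).hasDerivAt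
  have hc : HasDerivAt (fun t ↦ ((E (P u t) : Metric.sphere (0 : EuclideanSpace ℝ (Fin 4)) 1) : EuclideanSpace ℝ (Fin 4)))
      (fderiv ℝ (fun x ↦ ((E x : Metric.sphere (0 : EuclideanSpace ℝ (Fin 4)) 1) : EuclideanSpace ℝ (Fin 4))) (P u s)
        (deriv (P u) s)) s := hEd.comp_hasDerivAt s hPd
  rw [hc.deriv]
  intro h0
  exact h.deriv_ne u hu s hs (h.immersion _ hx (by rw [h0, map_zero]))

/-- **The family is regular on `S`.** [folklore] -/
theorem deriv_fam_ne_zero {u : ℝ} (hu : u ∈ Icc (0 : ℝ) 1) {s : ℝ} (hs : s ∈ Icc s₁ s₂) : deriv (h.fam u) s ≠ 0 := by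
  obtain ⟨_, h12, _, h34, _⟩ := h.hs
  by_cases hin : s ∈ Ioo s₁ s₂
  · have hev : h.fam u =ᶠ[𝓝 s] fun s ↦ ((E (P u s) : Metric.sphere (0 : EuclideanSpace ℝ (Fin 4)) 1) : EuclideanSpace ℝ (Fin 4)) := by
      filter_upwards [Ioo_mem_nhds hin.1 hin.2] with s' hs' using h.fam_of_mem u (Ioo_subset_Icc_self hs')
    rw [hev.deriv_eq]
    exact h.deriv_coe_track_ne_zero hu hs
  · have hs' : s = s₁ ∨ s = s₂ := by
      rcases eq_or_lt_of_le hs.1 with h1 | h1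
      · exact Or.inl h1.symm
      rcases eq_or_lt_of_le hs.2 with h2 | h2
      · exact Or.inr h2
      exact absurd ⟨h1, h2⟩ hin
    have hev : h.fam u =ᶠ[𝓝 s] Knot.curve k := by
      rcases hs' with rfl | rfl
      · filter_upwards [Iio_mem_nhds h12] with s' hs' using h.fam_of_not_mem u (fun hh ↦ absurd hh.1 (not_lt.2 hs'.le))
      · filter_upwards [Ioi_mem_nhds h34] with s' hs' using h.fam_of_not_mem u (fun hh ↦ absurd hh.2 (not_lt.2 hs'.le))
    rw [hev.deriv_eq]; exact k.deriv_curve_ne_zero s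

/-- **The family of modifications of `k`.** [folklore] -/
theorem isModification : k.IsModification a ε h.fam (Icc s₁ s₂) where
  ε_pos := h.ε_pos
  contDiff := h.contDiff_fam
  subset := Icc_subset_Icc h.hs.1 h.hs.2.2.2.2
  isClosed := isClosed_Icc
  eq_curve u t ht := h.fam_of_not_mem u (fun hh ↦ ht ⟨(h.hs.2.1.trans hh.1).le, (hh.2.trans h.hs.2.2.2.1).le⟩)
  zero_eq := h.fam_zero
  norm_eq_one u _ s hs := by rw [h.fam_of_mem u hs]; exact norm_eq_of_mem_sphere _
  deriv_ne_zero _ hu _ hs := h.deriv_fam_ne_zero hu hs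
  injOn u hu s hs s' hs' he := by
    rw [h.fam_of_mem u hs, h.fam_of_mem u hs'] at he
    exact h.injOn u hu hs hs' (h.inj (h.memU u hu s hs) (h.memU u hu s' hs') (Subtype.ext he))
  disjoint u hu s hs t ht hts := by rw [h.fam_of_mem u hs]; exact h.disjoint u hu s hs t ht hts

/-- **The end knot** of the sheet family. [folklore] -/
def outKnot : Knot := h.isModification.knotAt 1

/-- **The end knot on `S`** is the sheet image of the final track. [folklore] -/
theorem outKnot_circlePt_of_mem {s : ℝ} (hs : s ∈ Icc s₁ s₂) : h.outKnot (circlePt s) = E (P 1 s) := by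
  apply Subtype.ext
  rw [outKnot, h.isModification.coe_knotAt_circlePt_of_mem 1 hs, Real.smoothTransition.one, h.fam_of_mem 1 hs]

/-- **The end knot off `S`** is the old knot. [folklore] -/
theorem outKnot_circlePt_of_not_mem {t : ℝ} (ht : t ∈ Ico a (a + 1)) (hts : t ∉ Icc s₁ s₂) :
    h.outKnot (circlePt t) = k (circlePt t) := by
  rw [outKnot, h.isModification.knotAt_apply_of_forall_not_mem 1 (fun s hs he ↦ ?_)]
  obtain ⟨m, hm⟩ := circlePt_eq_circlePt_iff.1 he
  have hsI : s ∈ Ico a (a + 1) := ⟨by linarith [hs.1, h.hs.1, h.ε_pos], by linarith [hs.2, h.hs.2.2.2.2, h.ε_pos]⟩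
  have h1 : (m : ℝ) < 1 := by linarith [hsI.2, ht.1]
  have h2 : (-1 : ℝ) < m := by linarith [hsI.1, ht.2]
  have h1' : m < 1 := by exact_mod_cast h1
  have h2' : -1 < m := by exact_mod_cast h2
  obtain rfl : m = 0 := by omega
  simp only [Int.cast_zero, add_zero] at hm
  exact hts (hm ▸ hs)

/-- **The ambient isotopy with support.** For every open `O` containing all sheet images
`E (P u s)`, `u ∈ [0, 1]`, `s ∈ S`, there is an ambient isotopy of `S³`, stationary off `O`, whose
end carries `k` onto the end knot. [cite: HirschDT1976, Ch. 8 §1, Thm. 1.3] -/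
theorem exists_ambientIsotopy {O : Set (Metric.sphere (0 : EuclideanSpace ℝ (Fin 4)) 1)} (hO : IsOpen O)
    (hOsub : ∀ u ∈ Icc (0 : ℝ) 1, ∀ s ∈ Icc s₁ s₂, E (P u s) ∈ O) :
    ∃ Θ : AmbientIsotopy (𝓡 3) (Metric.sphere (0 : EuclideanSpace ℝ (Fin 4)) 1),
      (∀ t y, y ∉ O → Θ.toFun t y = y) ∧ Θ.toFun 1 ∘ ⇑k = ⇑h.outKnot := by
  have hGO : ∀ y : Metric.sphere (0 : EuclideanSpace ℝ (Fin 4)) 1, y ∉ O → ∀ u ∈ Icc (0 : ℝ) 1,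
      ∀ s ∈ Icc s₁ s₂, (y : EuclideanSpace ℝ (Fin 4)) ≠ h.fam u s := by
    intro y hy u hu s hs he
    rw [h.fam_of_mem u hs] at he
    exact hy ((Subtype.ext he) ▸ hOsub u hu s hs)
  obtain ⟨Θ, hΘO, hΘ, -⟩ := h.isModification.exists_ambientIsotopy hO hGO
  exact ⟨Θ, hΘO, hΘ 1 ⟨zero_le_one, le_rfl⟩⟩

end SheetFamily

end Literature.Topology.FourManifolds
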